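import Summits.HodgeConjecture.HodgeConjecture.Theorems.MarkmanPartnerTransportPicardThreeK3SquaresOneCycleDegreeHodge
import Literature.AlgebraicGeometry.Motives.HodgeStructureK3TypeOddRank

/-!
# Route MarkmanPartnerTransport · crux `PicardThreeK3Squares` (stmt-HodgeConjecture-19652) —
# K3 surfaces of ODD Picard number have no complex multiplication; «one cycle suffices» without Buskin
# at `ρ(S) ∈ {7, 13}`

Huybrechts, *Lectures on K3 Surfaces*, Ch. 3 Rem. 3.3.14 (ii): "If `dim_ℚ T` is odd, then `K₀ = K`, i.e.
`K` is totally real … `[K : ℚ]` is even for a CM field" — in the tree on abstract carriers as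
`HodgeStructure.forall_conj_apply_eq_of_odd_finrank`. Read on a projective K3 surface through a marking
(the picture of `RealMultiplicationRanks` / `OneCycle`), with `dim_ℚ T(S) = 22 - ρ(S)`:

* `not_hasComplexMultiplication_of_odd_picard` — **a projective K3 surface of ODD Picard number is not of
  CM type** (`HasComplexMultiplication S` would give a rational Hodge endomorphism whose eigenvalue on
  the `2`-form, read as `ε(·)` in the endomorphism field of `T`, is non-real — impossible at odd rank);
  granted markings only.
* `hodgeConjectureFor_square_of_oneCycle_of_odd_picard` — hence at ODD `ρ(S) ∉ {2, 4, 6, 10}` (within the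
  crux: `ρ(S) ∈ {7, 13}`; the other odd ranks `3, 5, 9, 11, 15, 17, 19` are settled outright by
  `OddPrimeRanks`) the one-cycle theorem needs NO Buskin: one cycle-induced rational Hodge endomorphism
  with a non-rational `(2,0)`-eigenvalue ⇒ `HodgeConjectureFor 4 (S ⊗ S)`, granted markings ONLY;
  `hodgeConjectureFor_square_of_oneCycle_natDegree_of_odd_picard` — the degree form likewise.

No definition, no sorry; `Huybrechts_K3_marking_exists` is the only named-fact hypothesis. Prover seat
hodge-nonav-19652-p1 (gen 8), `--supports stmt-HodgeConjecture-19652`. Nothing here proves the crux or HC.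

References: Huybrechts, *Lectures on K3 Surfaces*, Ch. 3 (3.2), Rem. 3.3.14 (ii), Lemma 3.3.1; Zarhin,
J. reine angew. Math. 341 (1983), Thm. 1.5.1; van Geemen–Schütt, Forum Math. Sigma 13 (2025) e2, §2.1.
-/

set_option linter.dupNamespace false

noncomputable section


namespace Summit.HodgeConjecture.HodgeConjecture.Theorems.MarkmanPartnerTransport.OneCycle

open scoped Manifold TensorProduct
open Module CategoryTheory MonoidalCategory CartesianMonoidalCategory Polynomial
open Literature.AlgebraicGeometry Literature.AlgebraicGeometry.Motives Literature.AlgebraicGeometry.HodgeTheory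
open Literature.AlgebraicGeometry.Motives.HodgeStructure
open Literature.AlgebraicGeometry.Surfaces
open Literature.AlgebraicTopology.SingularHomology
open Summit.HodgeConjecture.HodgeConjecture.Theorems
open Summit.HodgeConjecture.HodgeConjecture.Theorems.NikulinTwinTransport
open Summit.HodgeConjecture.HodgeConjecture.Theorems.AnchorExistenceCMFloor
open Summit.HodgeConjecture.HodgeConjecture.Theorems.MarkmanPartnerTransport.RealMultiplicationRanks

variable {S : SchemeOver ℂ}

/-- **A projective K3 surface of odd Picard number has no complex multiplication** (Huybrechts Rem.
3.3.14 (ii): `dim_ℚ T(S) = 22 - ρ(S)` odd forces `End_Hdg T(S)` totally real), granted markings: a CM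
endomorphism `Ψ` (rational, Hodge, eigenvalue `μ` on the `2`-form with `Im μ ≠ 0`) restricts into
`E = End_Hdg(T)` of the marked transcendental Hodge structure with `ε(Ψ|_T) = μ`, and every embedding of
`E` is real at odd rank (`forall_conj_apply_eq_of_odd_finrank`). [cite: Huybrechts2016K3, Ch. 3 Rem. 3.3.14 (ii) and (3.2)]
[cite: Zarhin1983HodgeGroupsK3, Thm. 1.5.1] -/
theorem not_hasComplexMultiplication_of_odd_picard (hmark : Huybrechts_K3_marking_exists)
    (hS : IsK3Surface S) (hodd : Odd (Module.finrank ℂ ↥(algebraicClasses S 1))) :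
    ¬ HasComplexMultiplication S := by
  intro hCMS
  obtain ⟨e, he_rat, he_typ, σ₀, ev, hσ₀20, hσ₀ne, hev, heσ₀⟩ := hCMS
  classical
  have hHT : Huybrechts_K3_hodgeTypes_H2 := Huybrechts_K3_hodgeTypes_H2_holds
  obtain ⟨η, p₀, x, hp₀, ⟨hp₀int, hp₀gen, hηint, hηcup, hx20, hx20'⟩, hxx, hxpos, hu⟩ := hmark S hS
  set N := algebraicClasses S 1 with hNdef
  set σ := η.symm x with hσdef
  have hησ : η σ = x := by rw [hσdef, LinearEquiv.apply_symm_apply]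
  have hxne : σ ≠ 0 := by
    intro h0
    have hx : x = 0 := by rw [← hησ, h0, map_zero]
    subst hx
    simp [k3Form] at hxpos
  have hxne' : x ≠ 0 := fun h => hxne (by rw [hσdef, h, map_zero])
  obtain ⟨h₁, -, h₃⟩ := hHT S hS σ hx20 hxne
  have hσbar : conjClass (ComplexPoints S) (2 * 1) σ = η.symm (star x) := conjClass_marking_symm η hηint x
  have hsmul0 : ∀ {c : ℂ}, c • p₀ = 0 → c = 0 := fun h => by
    rcases smul_eq_zero.1 h with h | h
    · exact h
    · exact absurd h hp₀
  have hL11 : ∀ c : complexBetti S (2 * 1), IsRationalClass c → IsOfHodgeType 2 S (2 * 1) 1 1 c → c ∈ N :=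
    fun c hc h11 => lefschetzOneOne_rational_holds hS.1 c hc h11
  have hND : ∀ c ∈ N, IsRationalClass c →
      (∀ d ∈ N, cupProduct (rfl : 2 * 1 + 2 * 1 = 2 * 2) c d = 0) → c = 0 :=
    fun c hcN hc hperp => anchorExistence_cmFloor_divisorClass_eq_zero_of_hodgeIndex
      hodgeIndex_surface_holds lefschetzOneOne_rational_holds
      Grothendieck1969_supportedClasses_le_hodgeConiveau_holds hS hcN hc hperp
  -- the eigenvalue of `e` on `σ`
  have heσ : e σ = ev • σ := by
    obtain ⟨t, ht⟩ := hx20' σ₀ hσ₀20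
    have ht0 : t ≠ 0 := by
      rintro rfl
      rw [zero_smul] at ht
      exact hσ₀ne ht
    have h := heσ₀
    rw [ht, map_smul, smul_comm] at h
    exact smul_right_injective _ ht0 h
  -- rational classes are `Λ_ℚ`
  have hrat : ∀ c, IsRationalClass c ↔ ∃ w : K3Index → ℚ, η c = fun i => (w i : ℂ) :=
    isRationalClass_iff_of_marking hS η hηint
  -- the rational points of `N`
  let NQ : Submodule ℚ (K3Index → ℚ) :=
    { carrier := {u | η.symm (fun j => (u j : ℂ)) ∈ N}
      add_mem' := fun {u v} hu hv => by
        simp only [Set.mem_setOf_eq, ratCastΛ_add, map_add]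
        exact N.add_mem hu hv
      zero_mem' := by
        simp only [Set.mem_setOf_eq, ratCastΛ_zero, map_zero]
        exact N.zero_mem
      smul_mem' := fun q u hu => by
        simp only [Set.mem_setOf_eq, ratCastΛ_smul, map_smul]
        exact N.smul_mem _ hu }
  have memNQ : ∀ u, u ∈ NQ ↔ η.symm (fun j => (u j : ℂ)) ∈ N := fun u => Iff.rfl
  -- `(1,1)`-classes through the marking
  have h11_iff : ∀ v : K3Index → ℂ, IsOfHodgeType 2 S (2 * 1) 1 1 (η.symm v) ↔
      (k3Form v x = 0 ∧ k3Form v (star x) = 0) := by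
    intro v
    rw [h₃ (η.symm v), hηcup, hηcup, LinearEquiv.apply_symm_apply, hησ, hσbar, LinearEquiv.apply_symm_apply]
    constructor
    · rintro ⟨ha, hb⟩
      exact ⟨hsmul0 ha, hsmul0 hb⟩
    · rintro ⟨ha, hb⟩
      rw [ha, hb, zero_smul]
      exact ⟨rfl, rfl⟩
  -- `N_ℚ = Λ_ℚ ∩ {x, x̄}^⊥`
  have hN : ∀ u : K3Index → ℚ, u ∈ NQ ↔
      (k3Form (fun i => (u i : ℂ)) x = 0 ∧ k3Form (fun i => (u i : ℂ)) (star x) = 0) := by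
    intro u
    rw [memNQ, ← h11_iff]
    constructor
    · intro hu
      exact isOfHodgeType_of_mem_algebraicClasses_of_isSmoothProjective hS.1 1 hu
    · intro hu
      exact hL11 _ ((hrat _).2 ⟨u, LinearEquiv.apply_symm_apply _ _⟩) hu
  -- `N` is spanned by its rational classes, so `N_ℚ^⊥ ⊗ ℂ ⊥ N`
  have hspan := span_isRationalClass_eq_top_of_isSmoothProjective_holds.supportedClasses_eq_span
    hS.1 (2 * 1) 1
  have horth : ∀ u ∈ k3FormRat.orthogonal NQ, ∀ d ∈ N, k3Form (fun j => (u j : ℂ)) (η d) = 0 := by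
    intro u hu d hd
    rw [LinearMap.BilinForm.mem_orthogonal_iff] at hu
    have hd' : d ∈ Submodule.span ℂ {c : complexBetti S (2 * 1) |
        IsRationalClass c ∧ c ∈ supportedClasses S (2 * 1) 1} := by
      rw [← hspan]; exact hd
    clear hd
    induction hd' using Submodule.span_induction with
    | mem d hd =>
      obtain ⟨w, hw⟩ := (hrat d).1 hd.1
      have hwN : w ∈ NQ := by
        rw [memNQ, ← hw, LinearEquiv.symm_apply_apply]
        exact hd.2
      rw [hw, k3Form_ratCast, k3FormRat_isSymm.eq, hu w hwN, Rat.cast_zero]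
    | zero => rw [map_zero, k3Form_zero_right]
    | add c c' _ _ hc hc' => rw [map_add, k3Form_add_right, hc, hc', add_zero]
    | smul t c _ hc => rw [map_smul, k3Form_smul_right, hc, mul_zero]
  -- `N_ℚ ∩ N_ℚ^⊥ = 0` (Hodge index)
  have hdisj : Disjoint NQ (k3FormRat.orthogonal NQ) := by
    rw [Submodule.disjoint_def]
    intro u huN huT
    have hc0 : η.symm (fun j => (u j : ℂ)) = 0 :=
      hND _ ((memNQ u).1 huN) ((hrat _).2 ⟨u, LinearEquiv.apply_symm_apply _ _⟩) fun d hd => by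
        rw [hηcup, LinearEquiv.apply_symm_apply, horth u huT d hd, zero_smul]
    apply ratCastΛ_injective
    rw [ratCastΛ_zero]
    exact η.symm.injective (hc0.trans (map_zero _).symm)
  have hc := isCompl_orthogonal hdisj
  -- the transcendental Hodge structure, irreducible of K3 type, polarized; its endomorphism field
  set H := hodgeT hN hdisj hxx hxpos with hH
  have hK3 : H.IsOfK3Type := isOfK3Type_hodgeT hN hdisj hxx hxpos
  have hirr : H.IsIrreducible := isIrreducible_hodgeT hN hdisj hxx hxpos
  set ψ : H.Polarization := polT hN hdisj hxx hxpos hu with hψ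
  obtain ⟨-, ε, -, hε⟩ := Zarhin1983_endAlg_isField_holds H hirr hK3
  have hω : omega x hdisj ∈ H.piece 2 0 := (mem_piece_two_zero_ofPeriod _ _).2 ⟨1, one_smul _ _⟩
  -- reading a rational type-preserving endomorphism of `H²(S)` in `E = End_Hdg(T)`
  have read : ∀ (G : complexBetti S (2 * 1) →ₗ[ℂ] complexBetti S (2 * 1)),
      (∀ y, IsRationalClass y → IsRationalClass (G y)) →
      (∀ (i j : ℕ) y, IsOfHodgeType 2 S (2 * 1) i j y → IsOfHodgeType 2 S (2 * 1) i j (G y)) →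
      ∃ (φ : Module.End ℚ (K3Index → ℚ)) (hφT : ∀ t ∈ k3FormRat.orthogonal NQ,
          φ t ∈ k3FormRat.orthogonal NQ),
        cxEnd φ = η.toLinearMap ∘ₗ G ∘ₗ η.symm.toLinearMap ∧ φ.restrict hφT ∈ H.endAlg := by
    intro G hG_rat hG_typ
    obtain ⟨φ, hφM, hφx, hφ11⟩ := anchorExistence_cmFloor_exists_ratEnd hHT hS η p₀ hp₀ hηint hηcup x hx20
      hx20' hxne G hG_rat hG_typ
    have hφT : ∀ t ∈ k3FormRat.orthogonal NQ, φ t ∈ k3FormRat.orthogonal NQ :=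
      fun t ht => map_mem_T hN φ hφx ht
    exact ⟨φ, hφT, hφM, restrict_mem_endAlg hN hdisj hxx hxpos φ hφT hφx hφ11⟩
  -- `dim_ℚ N_ℚ = dim_ℂ N`, hence `dim_ℚ T = 22 - ρ(S)`
  let b := Module.finBasis ℚ NQ
  let c : Fin (Module.finrank ℚ ↥NQ) → complexBetti S (2 * 1) :=
    fun i => η.symm (fun j => (((b i : NQ) : K3Index → ℚ) j : ℂ))
  have hcN : ∀ i, c i ∈ N := fun i => (memNQ _).1 (b i).2
  have hle : N ≤ Submodule.span ℂ (Set.range c) := by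
    intro d hd
    have hd' : d ∈ Submodule.span ℂ {c : complexBetti S (2 * 1) |
        IsRationalClass c ∧ c ∈ supportedClasses S (2 * 1) 1} := by
      rw [← hspan]; exact hd
    refine Submodule.span_le.2 ?_ hd'
    rintro d ⟨hdQ, hdN⟩
    obtain ⟨w, hw⟩ := (hrat d).1 hdQ
    have hwN : w ∈ NQ := by
      rw [memNQ, ← hw, LinearEquiv.symm_apply_apply]
      exact hdN
    have hd_eq : d = η.symm (fun j => (w j : ℂ)) := by rw [← hw, LinearEquiv.symm_apply_apply]
    have hw_eq : (w : K3Index → ℚ) = ∑ i, (b.repr ⟨w, hwN⟩ i) • ((b i : NQ) : K3Index → ℚ) := by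
      have h := congrArg (fun t : NQ => (t : K3Index → ℚ)) (b.sum_repr ⟨w, hwN⟩).symm
      simpa only [Submodule.coe_sum, Submodule.coe_smul] using h
    rw [SetLike.mem_coe, hd_eq, hw_eq, ratCastΛ_sum, map_sum]
    refine Submodule.sum_mem _ fun i _ => ?_
    rw [ratCastΛ_smul, map_smul]
    exact Submodule.smul_mem _ _ (Submodule.subset_span ⟨i, rfl⟩)
  haveI : Module.Finite ℂ ↥(Submodule.span ℂ (Set.range c)) :=
    Module.Finite.span_of_finite ℂ (Set.finite_range c)
  haveI : Module.Finite ℂ ↥N := Submodule.finiteDimensional_of_le hle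
  have hdimN_le : Module.finrank ℂ ↥N ≤ Module.finrank ℚ ↥NQ :=
    (Submodule.finrank_mono hle).trans ((finrank_range_le_card c).trans (by simp))
  have hcind : LinearIndependent ℂ c := by
    rw [Fintype.linearIndependent_iff]
    intro z hz i
    have hB := (Algebra.TensorProduct.basis ℂ b).linearIndependent
    rw [Fintype.linearIndependent_iff] at hB
    refine hB z ?_ i
    apply iota_injective NQ
    rw [map_sum, map_zero]
    have h := congrArg η hz
    rw [map_sum, map_zero] at h
    refine (Finset.sum_congr rfl fun j _ => ?_).trans h
    rw [map_smul, Algebra.TensorProduct.basis_apply, iota_one_tmul, map_smul, LinearEquiv.apply_symm_apply]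
  have hdimN_ge : Module.finrank ℚ ↥NQ ≤ Module.finrank ℂ ↥N := by
    let c' : Fin (Module.finrank ℚ ↥NQ) → ↥N := fun i => ⟨c i, hcN i⟩
    have hcomp : ⇑N.subtype ∘ c' = c := funext fun i => rfl
    have hc' : LinearIndependent ℂ c' := LinearIndependent.of_comp N.subtype (hcomp ▸ hcind)
    simpa using hc'.fintype_card_le_finrank
  have hdimN : Module.finrank ℚ ↥NQ = Module.finrank ℂ ↥N := le_antisymm hdimN_ge hdimN_le
  have hdimΛ : Module.finrank ℚ (K3Index → ℚ) = 22 := by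
    rw [Module.finrank_fintype_fun_eq_card]
    simp [Fintype.card_sum, Fintype.card_fin]
  have hdimT : Module.finrank ℚ ↥(k3FormRat.orthogonal NQ) + Module.finrank ℂ ↥N = 22 := by
    have h := Submodule.finrank_add_eq_of_isCompl hc
    omega
  obtain ⟨φe, hφeT, hφeM, hre⟩ := read e he_rat he_typ
  have hφeMapp : ∀ v, cxEnd φe v = η (e (η.symm v)) := fun v => by rw [hφeM]; rfl
  -- `ε(e|_T) = ev`
  have hεre : ε ⟨φe.restrict hφeT, hre⟩ = ev := by
    have h := hε ⟨φe.restrict hφeT, hre⟩ (omega x hdisj) hω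
    have h2 := congrArg (iota (k3FormRat.orthogonal NQ)) h
    have hval : ((⟨φe.restrict hφeT, hre⟩ : H.endAlg) : Module.End ℚ ↥(k3FormRat.orthogonal NQ)) =
        φe.restrict hφeT := rfl
    rw [hval, iota_baseChange_restrict φe hφeT, iota_omega hN hdisj, map_smul, iota_omega hN hdisj,
      hφeMapp, ← hσdef, heσ, map_smul, hησ] at h2
    have h3 : (ev - ε ⟨φe.restrict hφeT, hre⟩) • x = 0 := by rw [sub_smul, h2, sub_self]
    rcases smul_eq_zero.1 h3 with h4 | h4
    · exact (sub_eq_zero.1 h4).symm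
    · exact absurd h4 hxne'
  -- odd rank: every embedding of `E` is real (Huybrechts Rem. 3.3.14 (ii))
  have hoddT : Odd (Module.finrank ℚ ↥(k3FormRat.orthogonal NQ)) := by
    obtain ⟨r, hr⟩ := hodd
    refine ⟨(22 - Module.finrank ℂ ↥N) / 2, ?_⟩
    omega
  have hreal := HodgeStructure.forall_conj_apply_eq_of_odd_finrank hirr hK3 ψ hoddT ε.toRingHom
    ⟨φe.restrict hφeT, hre⟩
  change starRingEnd ℂ (ε ⟨φe.restrict hφeT, hre⟩) = ε ⟨φe.restrict hφeT, hre⟩ at hreal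
  rw [hεre] at hreal
  exact hev (Complex.conj_eq_iff_im.1 hreal)

/-- **ONE CYCLE SUFFICES without Buskin at odd Picard number** (`ρ(S)` odd, `ρ(S) ∉ {2, 4, 6, 10}` is
automatic; relevant new cases `ρ(S) ∈ {7, 13}`): a projective K3 surface with odd `ρ(S)` carrying one
endomorphism of `H²(S(ℂ); ℂ)` preserving rational classes and Hodge types, induced by an algebraic class on
`S × S`, with a non-rational eigenvalue on a non-zero `(2,0)`-class, satisfies `HodgeConjectureFor 4 (S ⊗ S)`
— granted MARKINGS ONLY (`not_hasComplexMultiplication_of_odd_picard` removes the CM branch).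
[cite: Huybrechts2016K3, Ch. 3 Rem. 3.3.14 (ii)] [cite: GeemenSchutt2023, §4.8 and Rem. 4.9]
[cite: Vangeemen2008, Lemma 3.2] -/
theorem hodgeConjectureFor_square_of_oneCycle_of_odd_picard (hmark : Huybrechts_K3_marking_exists)
    (hS : IsK3Surface S) (hodd : Odd (Module.finrank ℂ ↥(algebraicClasses S 1))) (μ : OrientationFamily)
    (e : complexBetti S (2 * 1) →ₗ[ℂ] complexBetti S (2 * 1))
    (he_rat : ∀ y, IsRationalClass y → IsRationalClass (e y))
    (he_typ : ∀ (i j : ℕ) y, IsOfHodgeType 2 S (2 * 1) i j y → IsOfHodgeType 2 S (2 * 1) i j (e y))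
    (he_cyc : ∃ γ ∈ algebraicClasses (S ⊗ S) 2, ∀ y : complexBetti S (2 * 1),
      e y = complexGysin μ (IsSmoothProjective.tensor_holds hS.isSmoothProjective hS.isSmoothProjective)
        hS.isSmoothProjective (SemiCartesianMonoidalCategory.fst _ _)
        (rfl : 2 * 1 + 2 * 2 + 2 * 2 = 2 * 1 + 2 * (2 + 2))
        (cupProduct (rfl : 2 * 1 + 2 * 2 = 2 * 1 + 2 * 2)
          (complexBetti.map (SemiCartesianMonoidalCategory.snd _ _) (2 * 1) y) γ))
    (he_ev : ∃ (σ₀ : complexBetti S (2 * 1)) (ev : ℂ), IsOfHodgeType 2 S (2 * 1) 2 0 σ₀ ∧ σ₀ ≠ 0 ∧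
      e σ₀ = ev • σ₀ ∧ ∀ a : ℚ, (a : ℂ) ≠ ev) :
    HodgeConjectureFor 4 (S ⊗ S) := by
  have h2 : Module.finrank ℂ ↥(algebraicClasses S 1) ≠ 2 := fun h => by rw [h] at hodd; exact (by decide : ¬ Odd 2) hodd
  have h4 : Module.finrank ℂ ↥(algebraicClasses S 1) ≠ 4 := fun h => by rw [h] at hodd; exact (by decide : ¬ Odd 4) hodd
  have h6 : Module.finrank ℂ ↥(algebraicClasses S 1) ≠ 6 := fun h => by rw [h] at hodd; exact (by decide : ¬ Odd 6) hodd
  have h10 : Module.finrank ℂ ↥(algebraicClasses S 1) ≠ 10 := fun h => by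
    rw [h] at hodd; exact (by decide : ¬ Odd 10) hodd
  exact hodgeConjectureFor_square_of_oneCycle hmark hS
    (fun _ _ hd hm h ↦ prime_of_mul_add_eq h2 h4 h6 h10 hd hm h)
    (not_hasComplexMultiplication_of_odd_picard hmark hS hodd) μ e he_rat he_typ he_cyc he_ev

/-- **The degree form without Buskin at odd Picard number.** [cite: Huybrechts2016K3, Ch. 3 Rem. 3.3.14 (ii)]
[cite: GeemenSchutt2023, §4.8] -/
theorem hodgeConjectureFor_square_of_oneCycle_natDegree_of_odd_picard (hmark : Huybrechts_K3_marking_exists)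
    (hS : IsK3Surface S) (hodd : Odd (Module.finrank ℂ ↥(algebraicClasses S 1))) {k : ℕ}
    (hk : ∀ j m : ℕ, 2 ≤ j → 3 ≤ m → k * j * m + Module.finrank ℂ ↥(algebraicClasses S 1) ≠ 22)
    (μ : OrientationFamily) (e : complexBetti S (2 * 1) →ₗ[ℂ] complexBetti S (2 * 1))
    (he_rat : ∀ y, IsRationalClass y → IsRationalClass (e y))
    (he_typ : ∀ (i j : ℕ) y, IsOfHodgeType 2 S (2 * 1) i j y → IsOfHodgeType 2 S (2 * 1) i j (e y))
    (he_cyc : ∃ γ ∈ algebraicClasses (S ⊗ S) 2, ∀ y : complexBetti S (2 * 1),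
      e y = complexGysin μ (IsSmoothProjective.tensor_holds hS.isSmoothProjective hS.isSmoothProjective)
        hS.isSmoothProjective (SemiCartesianMonoidalCategory.fst _ _)
        (rfl : 2 * 1 + 2 * 2 + 2 * 2 = 2 * 1 + 2 * (2 + 2))
        (cupProduct (rfl : 2 * 1 + 2 * 2 = 2 * 1 + 2 * 2)
          (complexBetti.map (SemiCartesianMonoidalCategory.snd _ _) (2 * 1) y) γ))
    (he_ev : ∃ (σ₀ : complexBetti S (2 * 1)) (ev : ℂ), IsOfHodgeType 2 S (2 * 1) 2 0 σ₀ ∧ σ₀ ≠ 0 ∧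
      e σ₀ = ev • σ₀ ∧ (minpoly ℚ ev).natDegree = k) :
    HodgeConjectureFor 4 (S ⊗ S) :=
  hodgeConjectureFor_square_of_oneCycle_natDegree hmark hS hk
    (not_hasComplexMultiplication_of_odd_picard hmark hS hodd) μ e he_rat he_typ he_cyc he_ev


/-! ### Appended: odd Picard number `≥ 17` — `End_Hdg T(S) = ℚ` without Buskin -/

/-- **HC⁴(S ⊗ S) for projective K3 surfaces of ODD Picard number `≥ 17` (i.e. `ρ(S) ∈ {17, 19}`),
granted markings only**: `HighPicard.scalar_or_hasComplexMultiplication_of_seventeen_le` (van Geemen: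
no real multiplication at rank `≤ 5`) leaves `E = ℚ` or CM, and CM is excluded at odd Picard number
(`not_hasComplexMultiplication_of_odd_picard`); the scalar case is the tree theorem
`SquareGlueFree.hodgeConjectureFor_square_of_hodgeEndomorphisms_scalar`. (Fills the `ρ = 17` entry left
open by `OddPrimeRanks.hodgeConjectureFor_square_of_picard_mem_oddPrimeRanks`, which lists
`{3, 5, 9, 11, 15, 19}`.) [cite: Vangeemen2008, Lemma 3.2] [cite: Huybrechts2016K3, Ch. 3 Rem. 3.3.14 (ii)] -/
theorem hodgeConjectureFor_square_of_odd_picard_seventeen_le (hmark : Huybrechts_K3_marking_exists)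
    (hS : IsK3Surface S) (hodd : Odd (Module.finrank ℂ ↥(algebraicClasses S 1)))
    (h17 : 17 ≤ Module.finrank ℂ ↥(algebraicClasses S 1)) : HodgeConjectureFor 4 (S ⊗ S) := by
  rcases HighPicard.scalar_or_hasComplexMultiplication_of_seventeen_le hmark hS h17 with hQ | hCM
  · exact SquareGlueFree.hodgeConjectureFor_square_of_hodgeEndomorphisms_scalar hS.isSmoothProjective hQ
  · exact absurd hCM (not_hasComplexMultiplication_of_odd_picard hmark hS hodd)

end Summit.HodgeConjecture.HodgeConjecture.Theorems.MarkmanPartnerTransport.OneCycle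

end
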